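import Summits.NavierStokesRegularity.FluidComputer.GateBudgetFiringTeeth
import HarnessLib

/-!
# What no tuning can beat, part 24a: THE GENERAL MEMBER — at clock death the carrier of ANY
# member sits at phase `wπ`, `w = ε/(Mρ²) = 1/(σ_knob M)` its winding number, up to the phase
# budget; given the levels its output is capped behind `|cos wπ|` and fired by `|sin wπ|`

Cell `pub-fluidc`, blueprint seat bp1 (gen 30, third item, first half); same namespace and
conventions as parts 1–23 (`GateBudget*.lean`); imports part 22a (`GateBudgetFiringTeeth`: the
transfer freeze and the drain, and through it parts 16, 17, 19, 20). Modes `0 = a` input,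
`1 = b` clock, `2 = c` catalyst (`u = c/ρ²`), `3 = d` transfer, `4 = ã` output; `σ_knob = ρ²/ε`.
HONEST FRAMING (verbatim): low prior, high value-of-information experiment on Tao's machine
paradigm; NOT a claim that NS blows up.

THE POINT. Parts 20–23 pinned the two EXTREMES of the knob's response: on the lattice
`w = ε/(Mρ²) = k` the member is a dud, on the half lattice `w = k + ½` it fires. This part and
its second half (part 24b `GateBudgetCombProfile`) treat EVERY member by the same mechanism.
§69: the total phase of the catalyst pulse at clock death is `wπ` up to the phase budget for ANY
real winding number `w ≥ 0` (`knob_winding_phase` = part 16's bracket; parts 16/22a's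
`knob_lattice_phase`, `knob_half_lattice_phase` are the cases `w = k`, `k + ½`), and if the total
phase is within `ψ` of an angle `φ` then `|d(T)| = |sin φ| ± (ψ + D)` and
`|a(T)| = |cos φ| ± (ψ + D)` (`knob_phase_exit`: `sin`, `cos` are 1-Lipschitz; part 16's total
tracking). §70, GIVEN the levels of part 17 (armed entry, catalyst alive, clock radius, dead
exit, pre-entry dose): the member's output is CAPPED, `ã(t)² ≤ 1 - (|cos wπ| - ψ - D)² + A` on
`[0, T + β/(2ε)]` (`knob_member_cap`: part 17's output cap behind the frozen carrier), and it
FIRES, `ã(t) ≥ θ` for `t ≥ T + β/(2ε)` whenever `0 ≤ θ ≤ K((|sin wπ| - ψ - D)² - A′ - θ²)β/(2ε)`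
(`knob_member_fire`: part 22a's transfer freeze and drain). Part 24b discharges the levels by
part 19 and puts in the numbers at `M = K¹⁰`: THE GATE'S TRANSFER CURVE IN THE PUMP RATE IS
`|sin(π/(σ_knob M))|`, of which the comb of parts 20–23 is the sample at the zeros and maxima.

HONEST LIMITS. (i) FIRST ORDER: `|sin Θ| ≥ |sin wπ| - ψ` is the Lipschitz bound; at the lattice
and half-lattice points parts 17/22a give the SECOND-order pins (`1 - ψ²/2`), which §69–§70 do
not reproduce. (ii) The cap holds on `[0, T + β/(2ε)]` only, the floor from `T + β/(2ε)` on only;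
nothing on the rise in between, no second-pulse exclusion. (iii) The floor is the LINEAR drain
bound of part 22a: `θ` solves `θ ≤ K(m - θ²)β/(2ε)`, not `θ = √m`. (iv) Every level and `ψ`,
`D`, `θ` are hypotheses here (discharged in part 24b). (v) Nothing about Navier–Stokes.
[cite: Tao2016AveragedNS, §5.5 Theorem 5.3, (5.5), (5.6), (b-eq), (c-eq), (tcable)]
-/

noncomputable section

namespace Summit.NavierStokesRegularity.FluidComputer.GateBudget

open Real Set Filter Topology
open Literature.Analysis.FluidPDE.Tao2016AveragedNS

variable {K M ε ρ : ℝ} {X : ℝ → Fin 5 → ℝ} {C : ℝ → ℝ}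

/-! ## §69 The winding phase and the exit at a general phase -/

/-- **THE WINDING PHASE.** On ANY member, written `ε = wMρ²` (`w = ε/(Mρ²) = 1/(σ_knob M) ≥ 0`
its winding number), with the window of part 16's `knob_phase_bracket`, swing `≥ π - η` and
pre-entry dose `|Φ₀| ≤ φ₀`: `|Θ - wπ| ≤ w(η + (πε²/(Mϱ²) + D₀)/(1 - ε²/(Mϱ²))) + φ₀` — the total
phase at clock death is `w` half turns up to the level losses (part 16's `knob_lattice_phase` and
part 22's `knob_half_lattice_phase` are the cases `w = k`, `w = k + ½`; same proof).
[cite: Tao2016AveragedNS, §5.5 Theorem 5.3, (5.5), (b-eq)] -/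
theorem knob_winding_phase
    (hX : ∀ t, HasDerivAt X (RotorKnob.rotorCircuit K M ε ρ (X t)) t)
    (h0 : X 0 = delayInit) (hε : 0 < ε) (hρ : 0 < ρ) (hM : 0 < M)
    (hC : ∀ t, HasDerivAt C (X t 2) t) (w : ℝ) (hw : 0 ≤ w) (hk : ε = w * M * ρ ^ 2)
    {s₀ T ϱ η φ₀ : ℝ} (hsT : s₀ ≤ T) (hϱ : 0 < ϱ) (hq : ε ^ 2 < M * ϱ ^ 2)
    (hc : ∀ t ∈ Icc s₀ T, 0 < X t 2) (hr : ∀ t ∈ Icc s₀ T, ϱ ^ 2 ≤ X t 1 ^ 2 + X t 2 ^ 2)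
    (hη : π - η ≤ arctan (X s₀ 1 / X s₀ 2) - arctan (X T 1 / X T 2))
    (hΦ₀ : |(C s₀ - C 0) / ρ ^ 2| ≤ φ₀) :
    |(C T - C 0) / ρ ^ 2 - w * π| ≤ w * (η + (π * (ε ^ 2 / (M * ϱ ^ 2))
        + ρ ^ 2 * exp (-M) * (T - s₀) / ϱ) / (1 - ε ^ 2 / (M * ϱ ^ 2))) + φ₀ := by
  obtain ⟨hlo, hhi⟩ := knob_phase_bracket hX h0 hε hρ hM hC hsT hϱ hq hc hr hη
  have hκ : ε / (M * ρ ^ 2) = w := by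
    rw [div_eq_iff (by positivity), hk]; ring
  rw [hκ] at hlo hhi
  have h1q : 0 < 1 - ε ^ 2 / (M * ϱ ^ 2) := sub_pos.2 ((div_lt_one (by positivity)).2 hq)
  have hq0 : 0 ≤ ε ^ 2 / (M * ϱ ^ 2) := by positivity
  have hD0 : 0 ≤ ρ ^ 2 * exp (-M) * (T - s₀) / ϱ := by
    have : 0 ≤ T - s₀ := by linarith
    positivity
  -- the excess `(πq + D₀)/(1 - q)` dominates `D₀`
  have hex : ρ ^ 2 * exp (-M) * (T - s₀) / ϱ ≤ (π * (ε ^ 2 / (M * ϱ ^ 2))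
      + ρ ^ 2 * exp (-M) * (T - s₀) / ϱ) / (1 - ε ^ 2 / (M * ϱ ^ 2)) := by
    rw [le_div_iff₀ h1q]
    nlinarith [mul_nonneg hD0 hq0, mul_nonneg pi_pos.le hq0]
  have hup : (π + ρ ^ 2 * exp (-M) * (T - s₀) / ϱ) / (1 - ε ^ 2 / (M * ϱ ^ 2))
      = π + (π * (ε ^ 2 / (M * ϱ ^ 2)) + ρ ^ 2 * exp (-M) * (T - s₀) / ϱ)
        / (1 - ε ^ 2 / (M * ϱ ^ 2)) := by
    have hne : M * ϱ ^ 2 - ε ^ 2 ≠ 0 := (sub_pos.2 hq).ne'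
    field_simp
    ring
  have hη0 : 0 < η := by linarith [swing_lt_pi (X s₀ 1 / X s₀ 2) (X T 1 / X T 2)]
  have hΦ₀' := abs_le.1 hΦ₀
  have hsplit : (C T - C 0) / ρ ^ 2 - w * π
      = ((C T - C s₀) / ρ ^ 2 - w * π) + (C s₀ - C 0) / ρ ^ 2 := by ring
  rw [hsplit]
  refine abs_le.2 ⟨?_, ?_⟩
  · have h := mul_le_mul_of_nonneg_left hex hw
    nlinarith [hlo, hΦ₀'.1, h, mul_nonneg hw hD0]
  · rw [mul_div_assoc, hup] at hhi
    nlinarith [hhi, hΦ₀'.2, mul_nonneg hw hη0.le]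

/-- **THE EXIT AT A GENERAL PHASE.** If the total phase is within `ψ` of an angle `φ`,
`|Θ - φ| ≤ ψ`, then at clock death `|sin φ| - ψ - D ≤ |d(T)| ≤ |sin φ| + ψ + D` and
`|cos φ| - ψ - D ≤ |a(T)| ≤ |cos φ| + ψ + D`, `D` the tracking drift of part 16
(`knob_total_tracking`; `sin` and `cos` are `1`-Lipschitz). FIRST order in `ψ`: at `φ ∈ (π/2)ℤ`
part 16's `knob_pinned_exit` and part 22's `knob_quadrature_exit` are second order.
[cite: Tao2016AveragedNS, §5.5 Theorem 5.3, (5.5), (5.6)] -/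
theorem knob_phase_exit (hX : ∀ t, HasDerivAt X (RotorKnob.rotorCircuit K M ε ρ (X t)) t)
    (h0 : X 0 = delayInit) (hC : ∀ t, HasDerivAt C (X t 2) t) (hε : 0 ≤ ε) (hK : 0 ≤ K)
    {s₀ T : ℝ} (hs₀ : 0 ≤ s₀) (hsT : s₀ ≤ T) {φ ψ : ℝ}
    (hψ : |(C T - C 0) / ρ ^ 2 - φ| ≤ ψ) :
    (|sin φ| - ψ - (4 * ((ε + ρ ^ 2 * exp (-M) + K * X s₀ 4) * s₀)
        + 2 * ((ε + ρ ^ 2 * exp (-M) + K * X T 4) * (T - s₀))) ≤ |X T 3| ∧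
      |X T 3| ≤ |sin φ| + ψ + (4 * ((ε + ρ ^ 2 * exp (-M) + K * X s₀ 4) * s₀)
        + 2 * ((ε + ρ ^ 2 * exp (-M) + K * X T 4) * (T - s₀)))) ∧
    (|cos φ| - ψ - (4 * ((ε + ρ ^ 2 * exp (-M) + K * X s₀ 4) * s₀)
        + 2 * ((ε + ρ ^ 2 * exp (-M) + K * X T 4) * (T - s₀))) ≤ |X T 0| ∧
      |X T 0| ≤ |cos φ| + ψ + (4 * ((ε + ρ ^ 2 * exp (-M) + K * X s₀ 4) * s₀)
        + 2 * ((ε + ρ ^ 2 * exp (-M) + K * X T 4) * (T - s₀)))) := by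
  obtain ⟨td, ta⟩ := knob_total_tracking hX h0 hC hε hK hs₀ hsT
  set Θ := (C T - C 0) / ρ ^ 2 with hΘ
  have hs : |sin Θ - sin φ| ≤ ψ := (Real.abs_sin_sub_sin_le Θ φ).trans hψ
  have hc : |cos Θ - cos φ| ≤ ψ := (Real.abs_cos_sub_cos_le Θ φ).trans hψ
  have h1 := abs_le.1 ((abs_abs_sub_abs_le_abs_sub (X T 3) (sin Θ)).trans td)
  have h2 := abs_le.1 ((abs_abs_sub_abs_le_abs_sub (sin Θ) (sin φ)).trans hs)
  have h3 := abs_le.1 ((abs_abs_sub_abs_le_abs_sub (X T 0) (cos Θ)).trans ta)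
  have h4 := abs_le.1 ((abs_abs_sub_abs_le_abs_sub (cos Θ) (cos φ)).trans hc)
  exact ⟨⟨by linarith [h1.1, h2.1], by linarith [h1.2, h2.2]⟩,
    ⟨by linarith [h3.1, h4.1], by linarith [h3.2, h4.2]⟩⟩

/-! ## §70 The general member, given the levels: capped behind the carrier, fired by the drain -/

/-- **THE GENERAL MEMBER IS CAPPED (given the levels).** Along `rotorCircuit K M ε ρ` from (5.6),
`ε = wMρ²` (`0 < ρ² ≤ ε ≤ 1`, `0 < M`, `0 ≤ K`), with the level hypotheses of part 17's
`knob_lattice_dud` (armed entry at `s₀`, catalyst alive and clock radius `≥ ϱ` on `[s₀, T]`,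
dead exit at `T`, pre-entry dose `≤ φ₀`), `ψ ≥ wζ + φ₀`, `D ≥` the drift and
`|cos wπ| - ψ - D ≥ 0`: for EVERY `t ∈ [0, T + β/(2ε)]`,
`ã(t)² ≤ 1 - (|cos wπ| - ψ - D)² + 4ε(λ₀ + ε)/(Mβ) + 4e^{-M}/M` — part 17's output cap
(`knob_output_cap`) behind `|a(T)| ≥ |cos wπ| - ψ - D` (§69). The case `w = k` is part 17's
`knob_lattice_dud` at first order. [cite: Tao2016AveragedNS, §5.5 Theorem 5.3, (energy-con)] -/
theorem knob_member_cap (hX : ∀ t, HasDerivAt X (RotorKnob.rotorCircuit K M ε ρ (X t)) t)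
    (h0 : X 0 = delayInit) (hε : 0 < ε) (hε1 : ε ≤ 1) (hρ : 0 < ρ) (hρε : ρ ^ 2 ≤ ε)
    (hM : 0 < M) (hK : 0 ≤ K) (hC : ∀ t, HasDerivAt C (X t 2) t) (w : ℝ) (hw : 0 ≤ w)
    (hk : ε = w * M * ρ ^ 2) {s₀ T ϱ β b₁ γ₁ lam₀ φ₀ ψ D : ℝ} (hs₀ : 0 ≤ s₀) (hsT : s₀ ≤ T)
    (hϱ : 0 < ϱ) (hq : ε ^ 2 < M * ϱ ^ 2) (hc : ∀ t ∈ Icc s₀ T, 0 < X t 2)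
    (hr : ∀ t ∈ Icc s₀ T, ϱ ^ 2 ≤ X t 1 ^ 2 + X t 2 ^ 2) (hb₁ : 0 < b₁) (hbs : b₁ ≤ X s₀ 1)
    (hcγ : X s₀ 2 ≤ γ₁) (hβ : 0 < β) (hbT : X T 1 ≤ -β) (hcl : X T 2 ≤ lam₀ * ρ ^ 2)
    (hΦ₀ : |(C s₀ - C 0) / ρ ^ 2| ≤ φ₀)
    (hψ : w * (arctan (γ₁ / b₁) + arctan (lam₀ * ρ ^ 2 / β) + (π * (ε ^ 2 / (M * ϱ ^ 2))
      + ρ ^ 2 * exp (-M) * (T - s₀) / ϱ) / (1 - ε ^ 2 / (M * ϱ ^ 2))) + φ₀ ≤ ψ)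
    (hD : 4 * ((ε + ρ ^ 2 * exp (-M) + K * X s₀ 4) * s₀)
      + 2 * ((ε + ρ ^ 2 * exp (-M) + K * X T 4) * (T - s₀)) ≤ D)
    (hm : 0 ≤ |cos (w * π)| - ψ - D) {t : ℝ} (ht : t ∈ Icc 0 (T + β / (2 * ε))) :
    X t 4 ^ 2 ≤ 1 - (|cos (w * π)| - ψ - D) ^ 2
      + (4 * ε * (lam₀ + ε) / (M * β) + 4 * exp (-M) / M) := by
  have hη := knob_swing_lower hb₁ hbs (hc s₀ ⟨le_rfl, hsT⟩) hcγ hβ hbT (hc T ⟨hsT, le_rfl⟩) hcl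
  have hph := knob_winding_phase hX h0 hε hρ hM hC w hw hk hsT hϱ hq hc hr hη hΦ₀
  obtain ⟨-, ha, -⟩ := knob_phase_exit hX h0 hC hε.le hK hs₀ hsT (hph.trans hψ)
  have hcap := knob_output_cap hX h0 hε hε1 hρ hρε hM hK (hs₀.trans hsT) hβ hbT ht
  -- `|a(T)| ≥ |cos wπ| - ψ - D ≥ 0`, so `a(T)² ≥ (|cos wπ| - ψ - D)²`
  have hpin : |cos (w * π)| - ψ - D ≤ |X T 0| := le_trans (by linarith) ha
  have hsqa : (|cos (w * π)| - ψ - D) ^ 2 ≤ X T 0 ^ 2 := by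
    rw [← sq_abs (X T 0)]
    exact pow_le_pow_left₀ hm hpin 2
  -- the afterglow is monotone in `u(T) ≤ λ₀`
  have hu : X T 2 / ρ ^ 2 ≤ lam₀ := by rwa [div_le_iff₀ (by positivity)]
  have hMβ : 0 < M * β := by positivity
  have hA : 4 * ε * (X T 2 / ρ ^ 2 + ε) / (M * β) ≤ 4 * ε * (lam₀ + ε) / (M * β) :=
    div_le_div_of_nonneg_right (mul_le_mul_of_nonneg_left (by linarith) (by positivity)) hMβ.le
  linarith

/-- **THE GENERAL MEMBER FIRES (given the levels).** Along `rotorCircuit K M ε ρ` from (5.6),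
`ε = wMρ²` (`0 < ε`, `0 < ρ`, `0 < M`, `0 ≤ K`), with the same level hypotheses, `ψ ≥ wζ + φ₀`,
`D ≥` the drift and `|sin wπ| - ψ - D ≥ 0`: (a) `|a(T)| ≤ |cos wπ| + ψ + D` and
`|d(T)| ≥ |sin wπ| - ψ - D` (§69), and (b) for every `θ ≥ 0` with
`θ ≤ K((|sin wπ| - ψ - D)² - A′ - θ²)·β/(2ε)`, `A′ = 2ελ₀/(Mβ) + e^{-M}/M`, the output satisfies
`ã(t) ≥ θ` for all `t ≥ T + β/(2ε)` — part 22's transfer freeze (`knob_transfer_freeze_selftimed`)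
holds `d² + ã² ≥ (|sin wπ| - ψ - D)² - A′` on the self-timed window and its drain
(`knob_drain_fires`) converts it. The case `w = k + ½` is part 22's `knob_lattice_fire` at first
order. [cite: Tao2016AveragedNS, §5.5 Theorem 5.3, (5.5), (5.6), (b-eq), (c-eq), (tcable)] -/
theorem knob_member_fire (hX : ∀ t, HasDerivAt X (RotorKnob.rotorCircuit K M ε ρ (X t)) t)
    (h0 : X 0 = delayInit) (hε : 0 < ε) (hρ : 0 < ρ) (hM : 0 < M) (hK : 0 ≤ K)
    (hC : ∀ t, HasDerivAt C (X t 2) t) (w : ℝ) (hw : 0 ≤ w) (hk : ε = w * M * ρ ^ 2)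
    {s₀ T ϱ β b₁ γ₁ lam₀ φ₀ ψ D θ : ℝ} (hs₀ : 0 ≤ s₀) (hsT : s₀ ≤ T)
    (hϱ : 0 < ϱ) (hq : ε ^ 2 < M * ϱ ^ 2) (hc : ∀ t ∈ Icc s₀ T, 0 < X t 2)
    (hr : ∀ t ∈ Icc s₀ T, ϱ ^ 2 ≤ X t 1 ^ 2 + X t 2 ^ 2) (hb₁ : 0 < b₁) (hbs : b₁ ≤ X s₀ 1)
    (hcγ : X s₀ 2 ≤ γ₁) (hβ : 0 < β) (hbT : X T 1 ≤ -β) (hcl : X T 2 ≤ lam₀ * ρ ^ 2)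
    (hΦ₀ : |(C s₀ - C 0) / ρ ^ 2| ≤ φ₀)
    (hψ : w * (arctan (γ₁ / b₁) + arctan (lam₀ * ρ ^ 2 / β) + (π * (ε ^ 2 / (M * ϱ ^ 2))
      + ρ ^ 2 * exp (-M) * (T - s₀) / ϱ) / (1 - ε ^ 2 / (M * ϱ ^ 2))) + φ₀ ≤ ψ)
    (hD : 4 * ((ε + ρ ^ 2 * exp (-M) + K * X s₀ 4) * s₀)
      + 2 * ((ε + ρ ^ 2 * exp (-M) + K * X T 4) * (T - s₀)) ≤ D)
    (hm : 0 ≤ |sin (w * π)| - ψ - D) (hθ : 0 ≤ θ)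
    (hfire : θ ≤ K * ((|sin (w * π)| - ψ - D) ^ 2 - (2 * ε * lam₀ / (M * β) + exp (-M) / M)
      - θ ^ 2) * (β / (2 * ε))) :
    |X T 0| ≤ |cos (w * π)| + ψ + D ∧ |sin (w * π)| - ψ - D ≤ |X T 3| ∧
      ∀ t, T + β / (2 * ε) ≤ t → θ ≤ X t 4 := by
  have hη := knob_swing_lower hb₁ hbs (hc s₀ ⟨le_rfl, hsT⟩) hcγ hβ hbT (hc T ⟨hsT, le_rfl⟩) hcl
  have hph := knob_winding_phase hX h0 hε hρ hM hC w hw hk hsT hϱ hq hc hr hη hΦ₀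
  obtain ⟨⟨hd, -⟩, -, ha⟩ := knob_phase_exit hX h0 hC hε.le hK hs₀ hsT (hph.trans hψ)
  have ha' : |X T 0| ≤ |cos (w * π)| + ψ + D := by linarith
  have hd' : |sin (w * π)| - ψ - D ≤ |X T 3| := le_trans (by linarith) hd
  refine ⟨ha', hd', ?_⟩
  -- at clock death the output pair holds at least `d(T)² ≥ (|sin wπ| - ψ - D)²`
  have hsqd : (|sin (w * π)| - ψ - D) ^ 2 ≤ X T 3 ^ 2 := by
    rw [← sq_abs (X T 3)]
    exact pow_le_pow_left₀ hm hd' 2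
  have hT0 : 0 ≤ T := hs₀.trans hsT
  have hu : X T 2 / ρ ^ 2 ≤ lam₀ := by rwa [div_le_iff₀ (by positivity)]
  have hMβ : 0 < M * β := by positivity
  have hA : 2 * ε * (X T 2 / ρ ^ 2) / (M * β) ≤ 2 * ε * lam₀ / (M * β) :=
    div_le_div_of_nonneg_right (mul_le_mul_of_nonneg_left hu (by positivity)) hMβ.le
  -- part 22 §62: the pair is frozen above `(|sin wπ| - ψ - D)² - A′` on the self-timed window
  have hfz : ∀ t ∈ Icc T (T + β / (2 * ε)),
      (|sin (w * π)| - ψ - D) ^ 2 - (2 * ε * lam₀ / (M * β) + exp (-M) / M)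
        ≤ X t 3 ^ 2 + X t 4 ^ 2 := fun t ht => by
    have h := knob_transfer_freeze_selftimed hX h0 hε hρ hM hT0 hβ hbT ht
    nlinarith [sq_nonneg (X T 4)]
  -- part 22 §63: the drain fires on it
  have hwin : T ≤ T + β / (2 * ε) := by
    have : 0 ≤ β / (2 * ε) := by positivity
    linarith
  have hfire' : θ ≤ K * ((|sin (w * π)| - ψ - D) ^ 2 - (2 * ε * lam₀ / (M * β) + exp (-M) / M)
      - θ ^ 2) * (T + β / (2 * ε) - T) := by
    have : T + β / (2 * ε) - T = β / (2 * ε) := by ring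
    rw [this]; exact hfire
  exact knob_drain_fires hX hK hwin (RotorKnob.e_nonneg hX h0 hK hT0) hθ hfz hfire'

end Summit.NavierStokesRegularity.FluidComputer.GateBudget
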